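import Summits.HodgeConjecture.HodgeConjecture.Theorems.K2E5QuatArchModuleLaw              -- ★ (this seat): `conjTranspose_map_embedding_of_hermitian`, `det_map_embedding_ne_zero`
import Literature.NumberTheory.Automorphic.UnitaryFormGroupUnimodular                      -- ★ `exists_conjTranspose_mul_mul_eq_diagonal_signs` (Sylvester), `formCongr_star`
import HarnessLib

/-!
# K2 ∕ E5 «TamagawaUnitary» — FILE `K2E5QuatArchSignatureDichotomy` ((19) G12∞, organ (Ind-S)): AN INVERTIBLE HERMITIAN `h_w ∈ M₂(ℂ)` IS DEFINITE OR CONGRUENT TO `diag(1, −1)`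

Cell `pub/hodgecm-mathlib`, Track B «K2-LIT», engine E5, crux H413 = `stmt-HodgeConjecture-24833`, route `route-HodgeConjecture-HCCMUnconditional`; dealer K2E5-plan (g2);
prover seat hodgecm-mathlib-K2E5-p22 (g2).  THEOREMS ONLY; lane `--supports stmt-HodgeConjecture-24833 --as helper`.

THE MATHEMATICS (Sylvester's law of inertia for `n = 2`).  ★ `exists_conjTranspose_mul_mul_eq_diagonal_signs`: `Tᴴ H T = diag(ε₀, ε₁)`, `εᵢ = ±1`.  Signs `(+,+)` ∕ `(−,−)`:
`±H = (T⁻¹)ᴴ T⁻¹`-congruent to `1₂`, hence `±H` positive definite (Mathlib `IsUnit.posDef_star_left_conjugate_iff`); `(+,−)`: `formCongr conj T H = diag(1,−1)`; `(−,+)`: swap the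
frame, `formCongr conj (T·P) H = diag(1,−1)` with `P = !![0,1;1,0]`.  This is the case split of the (19) head: ★ `quatArchPinCanonical_of_definite` (p856388) on the first two
branches, ★ `quatArchPinCanonical_of_indefinite_of_integral` on the third.
* `hermitian_two_dichotomy` — for `H ∈ M₂(ℂ)` hermitian invertible;  `map_embedding_dichotomy` — for `h_w = σ_w(h)`, `h` hermitian over the CM field with `det h ≠ 0`.

HONEST LABEL.  HC_CM is proved only modulo the 7 printed citations (2 remaining named inputs: hLiu418 = `stmt-HodgeConjecture-24832`, h413 = `stmt-HodgeConjecture-24833`)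
until rung 0 closes; this file moves no counter.

## References
* [HornJohnson2013] R. A. Horn, C. R. Johnson, *Matrix Analysis*, 2nd ed. (2013), §4.5 Thm. 4.5.7 (Sylvester's law of inertia).
* [PlatonovRapinchuk1994] V. Platonov, A. Rapinchuk, *Algebraic Groups and Number Theory* (1994), §2.3.
-/

set_option autoImplicit false
-- the mandated namespace repeats the single-problem summit's segment (`HodgeConjecture.HodgeConjecture`)
set_option linter.dupNamespace false

noncomputable section

open NumberField NumberField.InfinitePlace Matrix Complex
open scoped Matrix MatrixGroups ComplexConjugate ComplexOrder
open Literature.NumberTheory.Automorphic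

namespace Summit.HodgeConjecture.HodgeConjecture.Cruxes.H413.K2E5QuatArchLocal

/-- The swap matrix `P = !![0, 1; 1, 0]` has determinant `−1`. [folklore] -/
theorem det_swapTwo_ne_zero : (!![(0 : ℂ), 1; 1, 0]).det ≠ 0 := by
  rw [Matrix.det_fin_two_of]
  norm_num

/-- **SYLVESTER DICHOTOMY FOR `n = 2`**: an invertible hermitian `H ∈ M₂(ℂ)` is positive definite, negative definite, or `*`-congruent to `diag(1, −1)`.
[cite: HornJohnson2013, §4.5 Thm. 4.5.7] -/
theorem hermitian_two_dichotomy {H : Matrix (Fin 2) (Fin 2) ℂ} (hH : H.IsHermitian) (hdet : H.det ≠ 0) :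
    H.PosDef ∨ (-H).PosDef ∨ ∃ T : GL (Fin 2) ℂ, formCongr (starRingEnd ℂ) T H = Matrix.diagonal ![(1 : ℂ), -1] := by
  obtain ⟨T, ε, hε, hT⟩ := exists_conjTranspose_mul_mul_eq_diagonal_signs hH hdet
  have hTu : IsUnit (T : Matrix (Fin 2) (Fin 2) ℂ) := Units.isUnit T
  have hstar : star (T : Matrix (Fin 2) (Fin 2) ℂ) = (T : Matrix (Fin 2) (Fin 2) ℂ)ᴴ := rfl
  rcases hε 0 with h0 | h0 <;> rcases hε 1 with h1 | h1
  · -- `(+,+)`: `Tᴴ H T = 1`, `H` positive definite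
    left
    have hdiag : Matrix.diagonal (fun i => ((ε i : ℝ) : ℂ)) = 1 := by
      rw [← Matrix.diagonal_one]; congr 1; funext i; fin_cases i <;> simp [h0, h1]
    have h : (star (T : Matrix (Fin 2) (Fin 2) ℂ) * H * (T : Matrix (Fin 2) (Fin 2) ℂ)).PosDef := by
      rw [hstar, hT, hdiag]
      exact Matrix.PosDef.one
    exact (Matrix.IsUnit.posDef_star_left_conjugate_iff hTu).1 h
  · -- `(+,−)`: `T` itself
    right; right
    refine ⟨T, ?_⟩
    rw [formCongr_star, hT]
    congr 1; funext i; fin_cases i <;> simp [h0, h1]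
  · -- `(−,+)`: swap the frame
    right; right
    set P : GL (Fin 2) ℂ := Matrix.GeneralLinearGroup.mkOfDetNeZero !![(0 : ℂ), 1; 1, 0] det_swapTwo_ne_zero with hP
    have hPval : (P : Matrix (Fin 2) (Fin 2) ℂ) = !![(0 : ℂ), 1; 1, 0] := rfl
    refine ⟨T * P, ?_⟩
    rw [formCongr_star, Units.val_mul, Matrix.conjTranspose_mul]
    have hassoc : (P : Matrix (Fin 2) (Fin 2) ℂ)ᴴ * (T : Matrix (Fin 2) (Fin 2) ℂ)ᴴ * H * ((T : Matrix (Fin 2) (Fin 2) ℂ) * (P : Matrix (Fin 2) (Fin 2) ℂ)) =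
        (P : Matrix (Fin 2) (Fin 2) ℂ)ᴴ * ((T : Matrix (Fin 2) (Fin 2) ℂ)ᴴ * H * (T : Matrix (Fin 2) (Fin 2) ℂ)) * (P : Matrix (Fin 2) (Fin 2) ℂ) := by
      simp only [Matrix.mul_assoc]
    rw [hassoc, hT, hPval]
    ext i j
    fin_cases i <;> fin_cases j <;> simp [Matrix.mul_apply, Fin.sum_univ_two, Matrix.diagonal, h0, h1]
  · -- `(−,−)`: `Tᴴ (−H) T = 1`, `−H` positive definite
    right; left
    have hdiag : Matrix.diagonal (fun i => ((ε i : ℝ) : ℂ)) = -1 := by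
      have h1' : (-1 : Matrix (Fin 2) (Fin 2) ℂ) = Matrix.diagonal (fun _ => (-1 : ℂ)) := by
        rw [← Matrix.diagonal_one, ← Matrix.diagonal_neg]
      rw [h1']; congr 1; funext i; fin_cases i <;> simp [h0, h1]
    have h : (star (T : Matrix (Fin 2) (Fin 2) ℂ) * (-H) * (T : Matrix (Fin 2) (Fin 2) ℂ)).PosDef := by
      rw [hstar, Matrix.mul_neg, Matrix.neg_mul, hT, hdiag, neg_neg]
      exact Matrix.PosDef.one
    exact (Matrix.IsUnit.posDef_star_left_conjugate_iff hTu).1 h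

variable {L : Type} [Field L] [NumberField L] [IsCMField L] {Ha : Matrix (Fin 2) (Fin 2) L} (w : {w : InfinitePlace L // IsComplex w})

/-- **THE CASE SPLIT OF THE (19) HEAD**: for `h` hermitian over the CM field `L` (`(h.map c)ᵀ = h`) with `det h ≠ 0`, at every complex place `w` the matrix `h_w = σ_w(h)` is
positive definite, negative definite, or `*`-congruent to `diag(1, −1)`. [cite: HornJohnson2013, §4.5 Thm. 4.5.7] [cite: PlatonovRapinchuk1994, §2.3] -/
theorem map_embedding_dichotomy (hHa : (Ha.map (cmConjRingHom L)).transpose = Ha) (hdet : Ha.det ≠ 0) :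
    (Ha.map w.1.embedding).PosDef ∨ (-(Ha.map w.1.embedding)).PosDef ∨
      ∃ T : GL (Fin 2) ℂ, formCongr (starRingEnd ℂ) T (Ha.map w.1.embedding) = Matrix.diagonal ![(1 : ℂ), -1] :=
  hermitian_two_dichotomy (conjTranspose_map_embedding_of_hermitian w hHa) (det_map_embedding_ne_zero hdet)

end Summit.HodgeConjecture.HodgeConjecture.Cruxes.H413.K2E5QuatArchLocal

end
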